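import Summits.QuantumFields.YangMills.Theorems.AtomicCalibrationRShellSum

/-!
# AtomicCalibrationR (stmt-QuantumFields-28169), E2 `stub_offDiagonalWhitney` — shell summation restricted to the support
# (roadmap v2 item B.2 "level mass"; prover w4 g22, free hands)

`AtomicCalibrationRShellSum` asks for the count of ALL indices per unit shell.  For the level mass of construction (T) only the ALIVE
cubes (those near the coincidence locus, counted by `AtomicCalibrationRBandBridge.ncard_near_shell_le`) carry non-zero weight, and the
total number of cubes per shell grows with the wrong exponent.  This file restricts the count hypothesis to the support of `w`:

* `sum_le_of_shell_count_support`, `summable_of_shell_count_support`, `tsum_le_of_shell_count_support` — as in `ShellSum`, but with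
  `#{i | w i ≠ 0 ∧ ⌊N i⌋₊ = a} ≤ A (2+a)^D` (via the subtype `{i // w i ≠ 0}`).

Mathlib + `ShellSum` only; no stub/crux/rung/summit is closed; nothing here touches Yang–Mills; the YM mass gap is NOT proved. [folklore]
-/

set_option autoImplicit false

noncomputable section

open scoped BigOperators
open Set
open Summit.QuantumFields.YangMills.Cruxes.AtomicCalibrationR.ShellSum (sum_le_of_shell_count)

namespace Summit.QuantumFields.YangMills.Cruxes.AtomicCalibrationR.ShellSumSupport

variable {I : Type*}

/-- **Shell summation on the support, finite form.** -/
theorem sum_le_of_shell_count_support (N w : I → ℝ) (hN : ∀ i, 0 ≤ N i) {A B : ℝ} {D : ℕ} (hA : 0 ≤ A) (hB : 0 ≤ B)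
    (hfin : ∀ a : ℕ, {i | w i ≠ 0 ∧ ⌊N i⌋₊ = a}.Finite)
    (hcount : ∀ a : ℕ, (({i | w i ≠ 0 ∧ ⌊N i⌋₊ = a}.ncard : ℕ) : ℝ) ≤ A * (2 + a) ^ D)
    (hw : ∀ i, w i ≤ B / (1 + N i) ^ (D + 2)) (s : Finset I) :
    ∑ i ∈ s, w i ≤ 2 ^ (D + 1) * A * B := by
  classical
  -- pass to the subtype of the support
  let J := {i : I // w i ≠ 0}
  have hsum : ∑ i ∈ s, w i = ∑ j ∈ s.subtype (fun i => w i ≠ 0), w (j : I) := by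
    rw [Finset.sum_subtype_eq_sum_filter, Finset.sum_filter_ne_zero]
  rw [hsum]
  -- shells of the subtype inject into the support shells
  have hfinJ : ∀ a : ℕ, {j : J | ⌊N (j : I)⌋₊ = a}.Finite := by
    intro a
    have : {j : J | ⌊N (j : I)⌋₊ = a} = (Subtype.val : J → I) ⁻¹' {i | w i ≠ 0 ∧ ⌊N i⌋₊ = a} := by
      ext j; simp only [mem_setOf_eq, mem_preimage]; exact ⟨fun h => ⟨j.2, h⟩, fun h => h.2⟩
    rw [this]
    exact (hfin a).preimage (Subtype.val_injective.injOn)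
  have hcountJ : ∀ a : ℕ, (({j : J | ⌊N (j : I)⌋₊ = a}.ncard : ℕ) : ℝ) ≤ A * (2 + a) ^ D := by
    intro a
    refine le_trans ?_ (hcount a)
    have hmaps : ∀ j ∈ {j : J | ⌊N (j : I)⌋₊ = a}, (Subtype.val : J → I) j ∈ {i | w i ≠ 0 ∧ ⌊N i⌋₊ = a} :=
      fun j hj => ⟨j.2, hj⟩
    exact_mod_cast Set.ncard_le_ncard_of_injOn (Subtype.val : J → I) hmaps (Subtype.val_injective.injOn) (hfin a)
  exact sum_le_of_shell_count (fun j : J => N (j : I)) (fun j : J => w (j : I)) (fun j => hN _) hA hB hfinJ hcountJ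
    (fun j => hw _) _

/-- **Shell summation on the support**: summability. -/
theorem summable_of_shell_count_support (N w : I → ℝ) (hN : ∀ i, 0 ≤ N i) (hw0 : ∀ i, 0 ≤ w i) {A B : ℝ} {D : ℕ}
    (hA : 0 ≤ A) (hB : 0 ≤ B) (hfin : ∀ a : ℕ, {i | w i ≠ 0 ∧ ⌊N i⌋₊ = a}.Finite)
    (hcount : ∀ a : ℕ, (({i | w i ≠ 0 ∧ ⌊N i⌋₊ = a}.ncard : ℕ) : ℝ) ≤ A * (2 + a) ^ D)
    (hw : ∀ i, w i ≤ B / (1 + N i) ^ (D + 2)) : Summable w :=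
  summable_of_sum_le hw0 (sum_le_of_shell_count_support N w hN hA hB hfin hcount hw)

/-- **Shell summation on the support**: `Σ' w ≤ 2^{D+1} A B`. [folklore] -/
theorem tsum_le_of_shell_count_support (N w : I → ℝ) (hN : ∀ i, 0 ≤ N i) (hw0 : ∀ i, 0 ≤ w i) {A B : ℝ} {D : ℕ}
    (hA : 0 ≤ A) (hB : 0 ≤ B) (hfin : ∀ a : ℕ, {i | w i ≠ 0 ∧ ⌊N i⌋₊ = a}.Finite)
    (hcount : ∀ a : ℕ, (({i | w i ≠ 0 ∧ ⌊N i⌋₊ = a}.ncard : ℕ) : ℝ) ≤ A * (2 + a) ^ D)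
    (hw : ∀ i, w i ≤ B / (1 + N i) ^ (D + 2)) : ∑' i, w i ≤ 2 ^ (D + 1) * A * B :=
  Real.tsum_le_of_sum_le hw0 (sum_le_of_shell_count_support N w hN hA hB hfin hcount hw)

end Summit.QuantumFields.YangMills.Cruxes.AtomicCalibrationR.ShellSumSupport

end
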